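import Summits.CriticalPhenomena.PercolationContinuityZ3.Theorems.PercNearOneGluingNoHeavyQuantCherryCombModels
import HarnessLib

/-!
# QUANT lane R8, FAR on trees beyond block-combs: THE CHERRY MIXTURE STEP (a unit cherry is a mean-preserving mixture of two blob
# structures, so its tail dominates the smaller of theirs; canonical stemmed model)

builds on p205010 (kernel theorem, internal audit signed; external expert review pending)

Support file (`--supports stmt-CriticalPhenomena-4575`), QUANT lane seat prim-quant-p1 (gen 10); memo
`run/shared/lean/prim/quant/P1-SURPLUS.md` §21.  Theorems only (local notation, no definitions), no sorries, standard axioms.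
Model, notation and the three conditioned models of a unit cherry: `…QuantCherryCombModels.lean` (same seat).  Tool: THE BLOCK-COMB ROW
`Quant.BlockComb.tail_ge_of_le_marg_of_mean` (`…QuantBlockCombRow.lean`, p1 g9; independently `Quant.BlockComb.tail_ge_of_mean`, census-1 g13).

* `Quant.CherryComb.cherry_mixture_identity` — the three-point identity `(b + c − 2sbc)·E_H = (b + c − 2bc)·E_U + 2bc(1−s)·E_G` between the
  expectations of any functional of `h ∈ {0,1,2}` under the cherry law, the detached law `Bernoulli(sb) + Bernoulli(sc)` and the glued law
  `2·Bernoulli(s(b+c)/2)` (all of mean `s(b+c)`); `cherry_sub_glue_identity` — `E_H − E_G = s(b + c − 2bc)(F₁ − (F₀+F₂)/2)`.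
* `Quant.CherryComb.min_tail_detach_glue_le_tail` — **THE MIXTURE STEP**: for a unit cherry `(s₀; ℓ₁, ℓ₂)` of the stemmed model with gates in
  `[0,1]`, `min(TAILst U, TAILst G) ≤ TAILst H`: by `…QuantCherryCombModels` the three tails are depth sums of the expectations of one functional
  under the three laws, so `(b + c − 2sbc)·TAILst H = (b + c − 2bc)·TAILst U + 2bc(1−s)·TAILst G` with nonnegative coefficients (and
  `TAILst H = TAILst G` in the degenerate case `b + c = 2bc`).
The induction on the number of leaves (`…QuantCherryCombRow.lean`, same seat) turns this into FAR at every layer for every block-comb decorated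
with unit cherries / unit two-relay hairs: both `U` and `G` have two leaves fewer, the SAME mean `Σ a·marginal` and live marginals still above
the floor (`sb, sc ≥ y ⟹ s(b+c)/2 ≥ y`).
[this work]; mixture principle: prim-quant-census-1 GENERAL-ROW-G13 §7 (T4) (this lane); product weights [cite: Grimmett1999, §1.3 p. 10].
-/

namespace Summit.CriticalPhenomena.PercolationContinuityZ3.Theorems

namespace Quant

namespace CherryComb

open Finset

variable {κ : Type*} [Fintype κ] [DecidableEq κ]

/-- product-Bernoulli weight of the set `S` of open pieces -/
local notation3 "wt[" g ", " S "]" => ∏ k, (if k ∈ (S : Finset κ) then (g : κ → ℝ) k else 1 - (g : κ → ℝ) k)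

/-- product weight of `t` relative to the finset `U` of pieces -/
local notation3 "pw[" U ", " g ", " t "]" =>
  ∏ k ∈ (U : Finset κ), (if k ∈ (t : Finset κ) then (g : κ → ℝ) k else 1 - (g : κ → ℝ) k)

/-- probability that the chain `q` of length `D` is open exactly to depth `i` -/
local notation3 "pd[" D ", " q ", " i "]" =>
  (∏ i' ∈ Finset.range (i : ℕ), (q : ℕ → ℝ) i') * (if (i : ℕ) < (D : ℕ) then 1 - (q : ℕ → ℝ) i else 1)

/-- mass counted at depth `i` in blob configuration `S` (block-comb model) -/
local notation3 "mass[" lv ", " a ", " i ", " S "]" =>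
  ∑ k ∈ (S : Finset κ).filter (fun k => (lv : κ → ℕ) k ≤ (i : ℕ)), ((a : κ → ℕ) k : ℕ)

/-- the block-comb tail `P(N ≥ j+1)` -/
local notation3 "TAIL[" D ", " q ", " lv ", " a ", " g ", " j "]" =>
  ∑ i ∈ Finset.range ((D : ℕ) + 1), pd[D, q, i] *
    ∑ S : Finset κ, wt[g, S] * (if (j : ℕ) + 1 ≤ mass[lv, a, i, S] then (1 : ℝ) else 0)

/-- mass counted at depth `i` in configuration `S` of the STEMMED model: piece `k` counts when `lv k ≤ i`, `k ∈ S` and `st k ∈ S` -/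
local notation3 "massSt[" lv ", " a ", " st ", " i ", " S "]" =>
  ∑ k ∈ (S : Finset κ).filter (fun k => (lv : κ → ℕ) k ≤ (i : ℕ) ∧ (st : κ → κ) k ∈ (S : Finset κ)), ((a : κ → ℕ) k : ℕ)

/-- the stemmed tail `P(N ≥ j+1)` -/
local notation3 "TAILst[" D ", " q ", " lv ", " a ", " g ", " st ", " j "]" =>
  ∑ i ∈ Finset.range ((D : ℕ) + 1), pd[D, q, i] *
    ∑ S : Finset κ, wt[g, S] * (if (j : ℕ) + 1 ≤ massSt[lv, a, st, i, S] then (1 : ℝ) else 0)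

/-! ### 1. The three-point identities -/

omit [Fintype κ] [DecidableEq κ] in
/-- **The three-point identity.**  For reals `s, b, c` and values `F₀, F₁, F₂` of a functional of `h ∈ {0,1,2}`:
`(b + c − 2sbc)·E_H = (b + c − 2bc)·E_U + 2bc(1−s)·E_G`, where `E_H, E_U, E_G` are the expectations under the cherry law, the law of
`Bernoulli(sb) + Bernoulli(sc)`, and the law of `2·Bernoulli(s(b+c)/2)`. [this work] -/
theorem cherry_mixture_identity (s b c F₀ F₁ F₂ : ℝ) :
    (b + c - 2 * s * b * c) *
        (s * (b * c * F₂ + (b * (1 - c) + (1 - b) * c) * F₁ + (1 - b) * (1 - c) * F₀) + (1 - s) * F₀) =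
      (b + c - 2 * b * c) *
          ((s * b) * (s * c) * F₂ + ((s * b) * (1 - s * c) + (1 - s * b) * (s * c)) * F₁ + (1 - s * b) * (1 - s * c) * F₀) +
        2 * b * c * (1 - s) * (s * (b + c) / 2 * F₂ + (1 - s * (b + c) / 2) * F₀) := by
  ring

omit [Fintype κ] [DecidableEq κ] in
/-- The cherry law and the glued law differ by `s·(b + c − 2bc)·(F₁ − (F₀ + F₂)/2)` on any functional; in particular they agree when
`b + c = 2bc`. [this work] -/
theorem cherry_sub_glue_identity (s b c F₀ F₁ F₂ : ℝ) :
    (s * (b * c * F₂ + (b * (1 - c) + (1 - b) * c) * F₁ + (1 - b) * (1 - c) * F₀) + (1 - s) * F₀) -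
        (s * (b + c) / 2 * F₂ + (1 - s * (b + c) / 2) * F₀) =
      s * (b + c - 2 * b * c) * (F₁ - (F₀ + F₂) / 2) := by
  ring

/-! ### 2. The mixture step -/

/-- **THE CHERRY MIXTURE STEP.**  In the stemmed model, for a unit cherry `(s₀; ℓ₁, ℓ₂)` (stem of size `0`, `st s₀ = s₀`, two leaves
`ℓ₁ ≠ ℓ₂` of size `m` at the stem's level, fibre of `st` over `s₀` exactly `{s₀, ℓ₁, ℓ₂}`, the leaves no stems) with gates in `[0,1]`:
`min(TAILst U, TAILst G) ≤ TAILst H`, where `U` detaches the leaves as independent blobs on gates `g s₀·g ℓ₁`, `g s₀·g ℓ₂` and `G` glues the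
cherry into one blob of size `2m` on gate `g s₀·(g ℓ₁ + g ℓ₂)/2`. [this work] -/
theorem min_tail_detach_glue_le_tail (D : ℕ) (q : ℕ → ℝ) (lv : κ → ℕ) (a : κ → ℕ) (g : κ → ℝ) (st : κ → κ)
    (s₀ ℓ₁ ℓ₂ : κ) (m : ℕ) (h12 : ℓ₁ ≠ ℓ₂) (h1 : s₀ ≠ ℓ₁) (h2 : s₀ ≠ ℓ₂) (hst0 : st s₀ = s₀) (hst1 : st ℓ₁ = s₀)
    (hst2 : st ℓ₂ = s₀) (hfib : ∀ k, st k = s₀ → k = s₀ ∨ k = ℓ₁ ∨ k = ℓ₂) (hnl1 : ∀ k, st k ≠ ℓ₁) (hnl2 : ∀ k, st k ≠ ℓ₂)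
    (ha0 : a s₀ = 0) (ha1 : a ℓ₁ = m) (ha2 : a ℓ₂ = m) (hlv1 : lv ℓ₁ = lv s₀) (hlv2 : lv ℓ₂ = lv s₀)
    (hg0 : 0 ≤ g s₀ ∧ g s₀ ≤ 1) (hg1 : 0 ≤ g ℓ₁ ∧ g ℓ₁ ≤ 1) (hg2 : 0 ≤ g ℓ₂ ∧ g ℓ₂ ≤ 1) (j : ℕ) :
    min (TAILst[D, q, lv, a, (Function.update (Function.update g ℓ₁ (g s₀ * g ℓ₁)) ℓ₂ (g s₀ * g ℓ₂)),
            (Function.update (Function.update st ℓ₁ ℓ₁) ℓ₂ ℓ₂), j])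
        (TAILst[D, q, lv, (Function.update (Function.update (Function.update a s₀ (2 * m)) ℓ₁ 0) ℓ₂ 0),
            (Function.update g s₀ (g s₀ * (g ℓ₁ + g ℓ₂) / 2)), (Function.update (Function.update st ℓ₁ ℓ₁) ℓ₂ ℓ₂), j]) ≤
      TAILst[D, q, lv, a, g, st, j] := by
  -- per depth: the exact convex identity and the degenerate coincidence
  have key : ∀ i : ℕ,
      (g ℓ₁ + g ℓ₂ - 2 * g s₀ * g ℓ₁ * g ℓ₂) *
          (∑ S : Finset κ, wt[g, S] * (if j + 1 ≤ massSt[lv, a, st, i, S] then (1 : ℝ) else 0)) =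
        (g ℓ₁ + g ℓ₂ - 2 * g ℓ₁ * g ℓ₂) *
            (∑ S : Finset κ, wt[(Function.update (Function.update g ℓ₁ (g s₀ * g ℓ₁)) ℓ₂ (g s₀ * g ℓ₂)), S] *
              (if j + 1 ≤ massSt[lv, a, (Function.update (Function.update st ℓ₁ ℓ₁) ℓ₂ ℓ₂), i, S] then (1 : ℝ) else 0)) +
          2 * g ℓ₁ * g ℓ₂ * (1 - g s₀) *
            (∑ S : Finset κ, wt[(Function.update g s₀ (g s₀ * (g ℓ₁ + g ℓ₂) / 2)), S] *
              (if j + 1 ≤ massSt[lv, (Function.update (Function.update (Function.update a s₀ (2 * m)) ℓ₁ 0) ℓ₂ 0),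
                (Function.update (Function.update st ℓ₁ ℓ₁) ℓ₂ ℓ₂), i, S] then (1 : ℝ) else 0)) := by
    intro i
    rw [inner_cherry_eq lv a g st s₀ ℓ₁ ℓ₂ m h12 h1 h2 hst0 hst1 hst2 hfib hnl1 hnl2 ha0 ha1 ha2 hlv1 hlv2 i j,
      inner_detach_eq lv a g st s₀ ℓ₁ ℓ₂ m h12 h1 h2 hst0 hfib hnl1 hnl2 ha0 ha1 ha2 hlv1 hlv2 i j,
      inner_glue_eq lv a g st s₀ ℓ₁ ℓ₂ m h12 h1 h2 hst0 hfib hnl1 hnl2 i j,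
      Finset.mul_sum, Finset.mul_sum, Finset.mul_sum, ← Finset.sum_add_distrib]
    refine Finset.sum_congr rfl fun t _ => ?_
    linear_combination (pw[((Finset.univ.erase ℓ₁).erase ℓ₂).erase s₀, g, t]) *
      cherry_mixture_identity (g s₀) (g ℓ₁) (g ℓ₂) (if j + 1 ≤ massSt[lv, a, st, i, t] then (1 : ℝ) else 0)
        (if j + 1 ≤ massSt[lv, a, st, i, t] + (if lv s₀ ≤ i then m else 0) then (1 : ℝ) else 0)
        (if j + 1 ≤ massSt[lv, a, st, i, t] + (if lv s₀ ≤ i then 2 * m else 0) then (1 : ℝ) else 0)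
  have key0 : g ℓ₁ + g ℓ₂ - 2 * g ℓ₁ * g ℓ₂ = 0 → ∀ i : ℕ,
      (∑ S : Finset κ, wt[g, S] * (if j + 1 ≤ massSt[lv, a, st, i, S] then (1 : ℝ) else 0)) =
        ∑ S : Finset κ, wt[(Function.update g s₀ (g s₀ * (g ℓ₁ + g ℓ₂) / 2)), S] *
          (if j + 1 ≤ massSt[lv, (Function.update (Function.update (Function.update a s₀ (2 * m)) ℓ₁ 0) ℓ₂ 0),
            (Function.update (Function.update st ℓ₁ ℓ₁) ℓ₂ ℓ₂), i, S] then (1 : ℝ) else 0) := by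
    intro hN i
    rw [inner_cherry_eq lv a g st s₀ ℓ₁ ℓ₂ m h12 h1 h2 hst0 hst1 hst2 hfib hnl1 hnl2 ha0 ha1 ha2 hlv1 hlv2 i j,
      inner_glue_eq lv a g st s₀ ℓ₁ ℓ₂ m h12 h1 h2 hst0 hfib hnl1 hnl2 i j]
    refine Finset.sum_congr rfl fun t _ => ?_
    congr 1
    refine sub_eq_zero.1 ?_
    rw [cherry_sub_glue_identity, hN, mul_zero, zero_mul]
  have hN0 : 0 ≤ g ℓ₁ + g ℓ₂ - 2 * g ℓ₁ * g ℓ₂ := by nlinarith [hg1.1, hg1.2, hg2.1, hg2.2]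
  have hDN : 0 ≤ 2 * g ℓ₁ * g ℓ₂ * (1 - g s₀) :=
    mul_nonneg (mul_nonneg (mul_nonneg (by norm_num) hg1.1) hg2.1) (sub_nonneg.2 hg0.2)
  by_cases hN : g ℓ₁ + g ℓ₂ - 2 * g ℓ₁ * g ℓ₂ = 0
  · -- degenerate cherry: the glued model has the same tail
    refine le_trans (min_le_right _ _) (le_of_eq ?_)
    exact (Finset.sum_congr rfl fun i _ => by rw [key0 hN i]).symm
  · have hNpos : 0 < g ℓ₁ + g ℓ₂ - 2 * g ℓ₁ * g ℓ₂ := lt_of_le_of_ne hN0 (Ne.symm hN)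
    have hDpos : 0 < g ℓ₁ + g ℓ₂ - 2 * g s₀ * g ℓ₁ * g ℓ₂ := by linarith
    -- the convex identity between the three tails
    have hI : (g ℓ₁ + g ℓ₂ - 2 * g s₀ * g ℓ₁ * g ℓ₂) * TAILst[D, q, lv, a, g, st, j] =
        (g ℓ₁ + g ℓ₂ - 2 * g ℓ₁ * g ℓ₂) *
            TAILst[D, q, lv, a, (Function.update (Function.update g ℓ₁ (g s₀ * g ℓ₁)) ℓ₂ (g s₀ * g ℓ₂)),
              (Function.update (Function.update st ℓ₁ ℓ₁) ℓ₂ ℓ₂), j] +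
          2 * g ℓ₁ * g ℓ₂ * (1 - g s₀) *
            TAILst[D, q, lv, (Function.update (Function.update (Function.update a s₀ (2 * m)) ℓ₁ 0) ℓ₂ 0),
              (Function.update g s₀ (g s₀ * (g ℓ₁ + g ℓ₂) / 2)), (Function.update (Function.update st ℓ₁ ℓ₁) ℓ₂ ℓ₂), j] := by
      rw [Finset.mul_sum, Finset.mul_sum, Finset.mul_sum, ← Finset.sum_add_distrib]
      refine Finset.sum_congr rfl fun i _ => ?_
      linear_combination (pd[D, q, i]) * key i
    refine le_of_mul_le_mul_left ?_ hDpos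
    rw [hI]
    have h1' := mul_le_mul_of_nonneg_left (min_le_left
      (TAILst[D, q, lv, a, (Function.update (Function.update g ℓ₁ (g s₀ * g ℓ₁)) ℓ₂ (g s₀ * g ℓ₂)),
        (Function.update (Function.update st ℓ₁ ℓ₁) ℓ₂ ℓ₂), j])
      (TAILst[D, q, lv, (Function.update (Function.update (Function.update a s₀ (2 * m)) ℓ₁ 0) ℓ₂ 0),
        (Function.update g s₀ (g s₀ * (g ℓ₁ + g ℓ₂) / 2)), (Function.update (Function.update st ℓ₁ ℓ₁) ℓ₂ ℓ₂), j])) hN0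
    have h2' := mul_le_mul_of_nonneg_left (min_le_right
      (TAILst[D, q, lv, a, (Function.update (Function.update g ℓ₁ (g s₀ * g ℓ₁)) ℓ₂ (g s₀ * g ℓ₂)),
        (Function.update (Function.update st ℓ₁ ℓ₁) ℓ₂ ℓ₂), j])
      (TAILst[D, q, lv, (Function.update (Function.update (Function.update a s₀ (2 * m)) ℓ₁ 0) ℓ₂ 0),
        (Function.update g s₀ (g s₀ * (g ℓ₁ + g ℓ₂) / 2)), (Function.update (Function.update st ℓ₁ ℓ₁) ℓ₂ ℓ₂), j])) hDN
    nlinarith [h1', h2']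

end CherryComb

end Quant

end Summit.CriticalPhenomena.PercolationContinuityZ3.Theorems
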